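/-
Copyright (c) 2026. Released under Apache 2.0 license as described in the file LICENSE.
Track B ∕ K2-LIT (cell `hodgecm-mathlib`, squad K2, ENGINE E1), crux h413 = `stmt-HodgeConjecture-24833`, route of record `HCCMUnconditional`.
Prover seat `hodgecm-mathlib-K2E3-p12` (g7).  Deal «P8 PROPER» — THE CLOSER, ED. 1 (dealer K2E1-plan (g6) ruling (34): hypothesis-first on the single letter `hK1`).
-/
import Summits.HodgeConjecture.HodgeConjecture.Theorems.K2E1SphericalEisensteinMeromorphicOfBallsU2       -- ★ p858943 (this seat) §1: exhaustion by balls + normal-form gluing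
import Summits.HodgeConjecture.HodgeConjecture.Theorems.K2E1SphericalEisensteinMeromorphicBallU2          -- ★ p859005 (this seat) §2: one ball from the letters
import Summits.HodgeConjecture.HodgeConjecture.Theorems.K2E1SphericalEisensteinMeromorphicConvDataCMTwo    -- ★∕📤 p859228 (this seat): the structural ball data, `h_i = η_i ∗ η_i`
import Summits.HodgeConjecture.HodgeConjecture.Theorems.K2E1BLConstantTermVectorsU2                      -- ★ p859032 (this seat): `α₁ = [H^z]`, `α₂ = [H^{1−z}]`
import Summits.HodgeConjecture.HodgeConjecture.Theorems.K2E1SphericalEisensteinSolvesXSystemU2Head         -- ★ p859100 (K2E4-p23): S1 `T(E_z) = ĥ(z)E_z`; brings ★ p859074 S2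
import Summits.HodgeConjecture.HodgeConjecture.Theorems.K2E1BLEisensteinMemHXCMTwo                       -- ★ p858951 (K2E1-p09): (b1) `E_z ∈ 𝓗_k(𝔛)` for `1 < Re z ≤ k`
import Summits.HodgeConjecture.HodgeConjecture.Theorems.K2E1BLUniquenessHunqCM                           -- ★ p859172 (K2E1-p02): P6′ one call `hunq_cm_two` (+ ★ p859128 payer `hδα₂`)
import Summits.HodgeConjecture.HodgeConjecture.Theorems.K2E1BLEvaluationFunctionalU2                     -- ★ p859142 (K2E1-p08): P3-D `exists_evalCLM_eisenstein_cm_two`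
import Summits.HodgeConjecture.HodgeConjecture.Theorems.K2E1BLFibreAverageInvarianceU                    -- ★ p858957 (K2E1-p08): `hdis'` as a theorem
import Summits.HodgeConjecture.HodgeConjecture.Theorems.K2E1IntertwinedSectionInvariance                 -- ★ `map_conj_toAdelic_eq_self_two` (`hconj` at `N = 2`)
import Summits.HodgeConjecture.HodgeConjecture.Theorems.K2E1TruncatedCuspDecayHK1CMTwo                  -- ★ p859321 (K2E1-p11): `hK1_cm_two_of` (K1 HIGH ★ p859116 ∘ bridge ★ p859247 ∘ BAND ★ p859263), ED. 2
import Summits.HodgeConjecture.HodgeConjecture.Theorems.K2E1TruncatedCuspConstantTermAEU2              -- ★ p859335 (K2-defs1): `ae_borelConstantTerm_indicator_comp_eq_zero_of_mem_HNcusp` ((ii), every rank), ED. 3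
import HarnessLib

/-!
# K2·E1 — `K2E1SphericalEisensteinMeromorphicU2` (P8 PROPER, THE CLOSER, ED. 1): THE WHOLE-PLANE MEROMORPHIC CONTINUATION OF THE SPHERICAL BOREL EISENSTEIN SERIES ON
# `U(1,1)_{L/L⁺}` VIA BERNSTEIN–LAPID — HYPOTHESIS-FIRST ON THE SINGLE LETTER `hK1` (K2's cusp decay of `R(η∗η)` on `𝓗_k(Z_{c₁})^cusp`, all levels)
# [arXiv:1911.02342, Thm 2.3, §2.4, §4 Claims 1–5 (pp. 9–10)]

Track B ∕ K2-LIT, crux h413 = `stmt-HodgeConjecture-24833`, route of record `HCCMUnconditional`; cell `hodgecm-mathlib`, squad K2, ENGINE E1, campaign EIS-R7-BL-SPH-2 ((ζ′) WIRING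
§3 P8; dealer K2E1-plan (g6) ruling (34) 2026-09-04: «CLOSER ED. 1 = HYPOTHESIS-FIRST ON THE SINGLE LETTER `hK1` — GO TODAY»).  Prover seat `hodgecm-mathlib-K2E3-p12` (g7).  THEOREMS ONLY
(no `def`, no `instance`, no notation, no named-fact `def … : Prop` hypothesis, no `sorry`); lane `--supports stmt-HodgeConjecture-24833 --as helper` (count-neutral).  Closes no socket.

MATHEMATICAL CONTENT.  For the spherical flat section `φ₀·H^z` of the Borel parabolic of `G = U(J₂)` over a CM extension `L/L⁺`, the Eisenstein series `E(φ₀H^z)(g) = Σ_{B(F)∖G(F)} φ₀H(γg)^z`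
(absolutely convergent for `Re z > 1`, ★ `K2E1BorelEisensteinRegularU`) has a continuation `Ec : ℂ → (G(𝔸) → ℂ)` with `z ↦ Ec z g` MEROMORPHIC ON ALL OF `ℂ` for every `g` and `Ec z = E(φ₀H^z)`
for `Re z > 1` — Bernstein–Lapid's soft proof [BernsteinLapid2019, §4]: on each ball `D_n = B(0, n+2)` with weight `k = n+3`, `E_z` is for `1 < Re z` the unique solution (`L²` + self-adjoint
uniqueness, ★ P6′) of a holomorphic Fredholm system in the Hilbert space `𝓗_k(𝔛) × ℂ` (Hecke equations `T_i ψ = ĥ_i(z)ψ` for a finite family of self-convolutions `h_i = η_i ∗ η_i` of smooth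
symmetric bi-`K`-invariant test functions with `ĥ_i = η̂_i²` covering the ball, constant term `cnst(ιψ) = φ₀[H^z] + b[H^{1−z}]`), locally of finite type by Claim 5 (compactness of `δ(h)` on the cusp
part = the letter `hK1`, ★ K2), whence a meromorphic solution family (★ P1a), scalarised through the evaluation functional `Λ_g ∘ δ(h_{i₀})` (★ P3-D) and divided by `ĥ_{i₀}`; the balls are
glued through meromorphic normal forms (★ §1).

THE HEAD **`sphericalEisenstein_meromorphic_cm_two_of_hK1`**.  Letters: STRUCTURAL — the automorphic measure `μ` on `𝔛`, a Haar measure `νG` on `G(𝔸)` (inversion invariant, s-finite), a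
Haar measure `ν` on `N(𝔸)` with a relatively compact fundamental domain `𝓕` of `N(F)` of non-zero measure, the covering weight `β` with the unfolded measure `μZ` on `Z = B(F)∖G(𝔸)` (`hβ`,
`hμZ`, ★ P2a-ι's frame); and THE SINGLE NON-STRUCTURAL LETTER **`hK1`** = K2's cusp-decay estimate (★ `K2E1TruncatedCuspCompactU2` bytes) for the right convolution by `η̃ ∗ η̃` (`η̃` the
lift to `G(𝔸)` of a smooth non-negative symmetric bi-`K`-invariant test function `η` on `GL₂(𝔸_L)`) from `𝓗_k(Z_{c₁})^cusp` to `Z_{c₀}`, for all `k` and all levels `0 < c₁`, `κ c₁ ≤ c₀` admitting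
the height comparison `HZ(z) ≤ κ·HZ(z·y)` on `tsupport (η̃ ∗ η̃)` — its HIGH half is ★ p859116 (mod `hcnst`), its BAND half is deal (25); ED. 2 (append-only) will discharge it by
`hK1_cm_two`.  Everything else is ★ BY NAME: ball data ★ `exists_convData_cm_two`, vectors ★ `exists_constantTermVectors`, (b1) ★ `eisensteinSeriesU_flatSectionU_memHX_cm_two`, S1 ★
`shiftOperatorX_toHX_eisensteinSeriesU_eq_smul_cm_two`, S2 ★ `exists_cnstN_iota_toHX_eisensteinSeriesU_eq_cm_two` with `hdis'` ★ `integral_zFun_borelConstantTerm_eq_of_unfolding` (`hconj` ★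
`map_conj_toAdelic_eq_self_two`), P6′ ★ `hunq_cm_two` with `hδα₂` ★ `exists_ae_norm_deltaShift_le_of_ae_eq_cpow`, P3-D ★ `exists_evalCLM_eisenstein_cm_two`, §2 ★
`sphericalEisenstein_meromorphicOn_ball_of_letters`, §1 ★ `sphericalEisenstein_meromorphic_of_balls`.
MILESTONE LABEL: «(R7-sph)₂ modulo hK1 (HIGH half ★ p859116 mod hcnst; BAND (25) + bridge (13)∕(17)∕(27) in flight)».
HONEST LABEL: HC_CM is proved only modulo the 7 printed citations (2 remaining named inputs: hLiu418 = `stmt-HodgeConjecture-24832`, h413 = `stmt-HodgeConjecture-24833`) until rung 0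
closes; this file asserts no named fact and closes no socket.
References: [BernsteinLapid2019] J. Bernstein, E. Lapid, *On the meromorphic continuation of Eisenstein series*, arXiv:1911.02342 (JAMS 37 (2024), doi:10.1090/jams/1020), Thm 2.3, §2.4,
§4 Claims 1–5 pp. 9–10; [Langlands1976] R. P. Langlands, *On the Functional Equations Satisfied by Eisenstein Series*, LNM 544, §7; [MoeglinWaldspurger1995] C. Mœglin, J.-L. Waldspurger,
*Spectral Decomposition and Eisenstein Series*, CUP, IV.1.8–IV.1.10.
-/

set_option autoImplicit false
-- the mandated namespace repeats the single-problem summit's segment (`HodgeConjecture.HodgeConjecture`)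
set_option linter.dupNamespace false

noncomputable section

open MeasureTheory Filter Topology Set NumberField
open scoped NNReal ENNReal Classical ComplexConjugate
open Literature.MeasureTheory.Group Literature.NumberTheory Literature.NumberTheory.Automorphic Literature.NumberTheory.Automorphic.UnitaryGroup AdelicGroupData
open Summit.HodgeConjecture.HodgeConjecture.Cruxes.H413.K2E1BorelEisensteinU
open Summit.HodgeConjecture.HodgeConjecture.Cruxes.H413.K2E1BLBorelSpacesU2Defs
open Summit.HodgeConjecture.HodgeConjecture.Cruxes.H413.K2E1BLBorelOperatorsU2Defs
open Summit.HodgeConjecture.HodgeConjecture.Cruxes.H413.K2E1BLIotaClosedEmbeddingU2 (iotaBound_cm isFiniteMeasure_weightedTruncMeasure_cm)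
open Summit.HodgeConjecture.HodgeConjecture.Cruxes.H413.K2E1BLQuotientMeasureU (measurePreserving_rightShift_of_unfolding)
open Summit.HodgeConjecture.HodgeConjecture.Cruxes.H413.K2E1SphericalEisensteinMeromorphicSuppliersU2 (measure_setOf_lt_ne_top_cm)
open Summit.HodgeConjecture.HodgeConjecture.Cruxes.H413.K2E1SphericalEisensteinMeromorphicConvDataCMTwo (exists_convData_cm_two)
open Summit.HodgeConjecture.HodgeConjecture.Cruxes.H413.K2E1BLConstantTermVectorsU2 (exists_constantTermVectors)
open Summit.HodgeConjecture.HodgeConjecture.Cruxes.H413.K2E1BLEisensteinMemHXCMTwo (eisensteinSeriesU_flatSectionU_memHX_cm_two)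
open Summit.HodgeConjecture.HodgeConjecture.Cruxes.H413.K2E1SphericalEisensteinSolvesXSystemU2 (shiftOperatorX_toHX_eisensteinSeriesU_eq_smul_cm_two exists_cnstN_iota_toHX_eisensteinSeriesU_eq_cm_two)
open Summit.HodgeConjecture.HodgeConjecture.Cruxes.H413.K2E1BLFibreAverageInvarianceU (integral_zFun_borelConstantTerm_eq_of_unfolding)
open Summit.HodgeConjecture.HodgeConjecture.Cruxes.H413.K2E1IntertwinedSectionInvariance (map_conj_toAdelic_eq_self_two)
open Summit.HodgeConjecture.HodgeConjecture.Cruxes.H413.K2E1BLUniquenessHunqCM (hunq_cm_two)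
open Summit.HodgeConjecture.HodgeConjecture.Cruxes.H413.K2E1BLHomogeneousL2U2 (exists_ae_norm_deltaShift_le_of_ae_eq_cpow)
open Summit.HodgeConjecture.HodgeConjecture.Cruxes.H413.K2E1BLEvaluationFunctionalU2 (exists_evalCLM_eisenstein_cm_two)
open Summit.HodgeConjecture.HodgeConjecture.Cruxes.H413.K2E1SphericalEisensteinMeromorphicBallU2 (sphericalEisenstein_meromorphicOn_ball_of_letters)
open Summit.HodgeConjecture.HodgeConjecture.Cruxes.H413.K2E1SphericalEisensteinMeromorphicOfBallsU2 (sphericalEisenstein_meromorphic_of_balls)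

namespace Summit.HodgeConjecture.HodgeConjecture.Cruxes.H413.K2E1SphericalEisensteinMeromorphicU2

variable (L : Type) [Field L] [NumberField L] [IsCMField L]
  [MeasurableSpace (quasiSplit (↥(maximalRealSubfield L)) L (IsCMField.complexConj L) 2).Adelic] [BorelSpace (quasiSplit (↥(maximalRealSubfield L)) L (IsCMField.complexConj L) 2).Adelic]

/-- **THE MEROMORPHIC CONTINUATION OF THE SPHERICAL BOREL EISENSTEIN SERIES ON `U(1,1)_{L/L⁺}` TO ALL OF `ℂ`, MODULO K2's CUSP-DECAY LETTER `hK1`** [BernsteinLapid2019, Thm 2.3, §4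
Claims 1–5] (module docstring): `∃ Ec, (∀ g, MeromorphicOn (Ec · g) univ) ∧ ∀ z, 1 < Re z → Ec z = E(φ₀H^z)`.
[cite: BernsteinLapid2019, Thm 2.3, §2.4 and §4 Claims 1–5 (pp. 9–10)] [cite: Langlands1976, §7] [cite: MoeglinWaldspurger1995, IV.1.8–IV.1.10] -/
theorem sphericalEisenstein_meromorphic_cm_two_of_hK1
    -- structural letters: the measures
    (μ : Measure (quasiSplit (↥(maximalRealSubfield L)) L (IsCMField.complexConj L) 2).automorphicQuotient) [(quasiSplit (↥(maximalRealSubfield L)) L (IsCMField.complexConj L) 2).IsAutomorphicMeasure μ]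
    (νG : Measure (quasiSplit (↥(maximalRealSubfield L)) L (IsCMField.complexConj L) 2).Adelic) [νG.IsHaarMeasure] [νG.IsInvInvariant] [SFinite νG]
    (ν : Measure ↥(adelicUnipotent (↥(maximalRealSubfield L)) L (IsCMField.complexConj L) 2)) [ν.IsHaarMeasure] [ν.IsMulRightInvariant] [ν.IsInvInvariant]
    {𝓕 : Set ↥(adelicUnipotent (↥(maximalRealSubfield L)) L (IsCMField.complexConj L) 2)}
    (h𝓕N : IsFundamentalDomain ↥(rationalUnipotent (↥(maximalRealSubfield L)) L (IsCMField.complexConj L) 2) 𝓕 ν) (h𝓕c : IsCompact (closure 𝓕)) (h𝓕₀ : ν 𝓕 ≠ 0)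
    {β : (quasiSplit (↥(maximalRealSubfield L)) L (IsCMField.complexConj L) 2).Adelic → ℝ≥0∞}
    (hβ : IsCoveringWeight ↥((arithmeticBorel (↥(maximalRealSubfield L)) L (IsCMField.complexConj L) 2).map (quasiSplit (↥(maximalRealSubfield L)) L (IsCMField.complexConj L) 2).arithmeticSubgroup.subtype) β)
    {μZ : Measure (borelQuotient (↥(maximalRealSubfield L)) L (IsCMField.complexConj L) 2)} [SFinite μZ]
    (hμZ : ∀ f : borelQuotient (↥(maximalRealSubfield L)) L (IsCMField.complexConj L) 2 → ℝ≥0∞, Measurable f → ∫⁻ z, f z ∂μZ = ∫⁻ g, β g * f (toBorelQuotient (↥(maximalRealSubfield L)) L (IsCMField.complexConj L) 2 g) ∂νG)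
    -- THE letter: K2's cusp decay for the self-convolution test functions, at all levels
    (hK1 : ∀ η : GL (Fin 2) (AdeleRing (𝓞 L) L) → ℝ, IsTestFunctionGL 2 L η → (∀ g, 0 ≤ η g) → (∀ g, η g⁻¹ = η g) →
      (∀ k₁ k₂ : (quasiSplit (↥(maximalRealSubfield L)) L (IsCMField.complexConj L) 2).Adelic, adelicVal (↥(maximalRealSubfield L)) L (IsCMField.complexConj L) 2 ((StdForm.antidiagonal 2).over L) k₁ ∈ standardMaximalCompactGL 2 L → adelicVal (↥(maximalRealSubfield L)) L (IsCMField.complexConj L) 2 ((StdForm.antidiagonal 2).over L) k₂ ∈ standardMaximalCompactGL 2 L →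
          ∀ x, η (adelicVal (↥(maximalRealSubfield L)) L (IsCMField.complexConj L) 2 ((StdForm.antidiagonal 2).over L) (k₁ * x * k₂)) = η (adelicVal (↥(maximalRealSubfield L)) L (IsCMField.complexConj L) 2 ((StdForm.antidiagonal 2).over L) x)) →
      ∀ (k : ℕ) (c₁ c₀ κ : ℝ≥0), 0 < c₁ → 1 ≤ κ → κ * c₁ ≤ c₀ →
        (∀ z : borelQuotient (↥(maximalRealSubfield L)) L (IsCMField.complexConj L) 2, ∀ y ∈ tsupport (fun y : (quasiSplit (↥(maximalRealSubfield L)) L (IsCMField.complexConj L) 2).Adelic => orbitalSmoothing νG (fun x : (quasiSplit (↥(maximalRealSubfield L)) L (IsCMField.complexConj L) 2).Adelic => ((η (adelicVal (↥(maximalRealSubfield L)) L (IsCMField.complexConj L) 2 ((StdForm.antidiagonal 2).over L) x) : ℝ) : ℂ)) (fun x : (quasiSplit (↥(maximalRealSubfield L)) L (IsCMField.complexConj L) 2).Adelic => ((η (adelicVal (↥(maximalRealSubfield L)) L (IsCMField.complexConj L) 2 ((StdForm.antidiagonal 2).over L) x) : ℝ) : ℂ)) y), borelQuotHeight (↥(maximalRealSubfield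 L)) L (IsCMField.complexConj L) 2 z ≤ κ * borelQuotHeight (↥(maximalRealSubfield L)) L (IsCMField.complexConj L) 2 (rightShift (↥(maximalRealSubfield L)) L (IsCMField.complexConj L) 2 y z)) →
        ∃ m C : ℝ, 0 ≤ m ∧ 0 ≤ C ∧ ∀ f : HNcusp (↥(maximalRealSubfield L)) L (IsCMField.complexConj L) 2 k c₁ μZ, ∀ᵐ z ∂(weightedTruncMeasure (↥(maximalRealSubfield L)) L (IsCMField.complexConj L) 2 k c₀ μZ),
          ‖rightConvFun (↥(maximalRealSubfield L)) L (IsCMField.complexConj L) 2 νG (fun y : (quasiSplit (↥(maximalRealSubfield L)) L (IsCMField.complexConj L) 2).Adelic => orbitalSmoothing νG (fun x : (quasiSplit (↥(maximalRealSubfield L)) L (IsCMField.complexConj L) 2).Adelic => ((η (adelicVal (↥(maximalRealSubfield L)) L (IsCMField.complexConj L) 2 ((StdForm.antidiagonal 2).over L) x) : ℝ) : ℂ)) (fun x : (quasiSplit (↥(maximalRealSubfield L)) L (IsCMField.complexConj L) 2).Adelic => ((η (adelicVal (↥(maximalRealSubfield L)) L (IsCMField.complexConj L) 2 ((StdForm.antidiagonal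 2).over L) x) : ℝ) : ℂ)) y) ((f : HN (↥(maximalRealSubfield L)) L (IsCMField.complexConj L) 2 k c₁ μZ) : borelQuotient (↥(maximalRealSubfield L)) L (IsCMField.complexConj L) 2 → ℂ) z‖ ≤ C * ‖f‖ * ((borelQuotHeight (↥(maximalRealSubfield L)) L (IsCMField.complexConj L) 2 z : ℝ)) ^ (-m))
    (φ₀ : ℂ) :
    ∃ Ec : ℂ → (quasiSplit (↥(maximalRealSubfield L)) L (IsCMField.complexConj L) 2).Adelic → ℂ,
      (∀ g, MeromorphicOn (fun z => Ec z g) univ) ∧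
      ∀ z : ℂ, 1 < z.re → Ec z = eisensteinSeriesU (flatSectionU (fun _ : (quasiSplit (↥(maximalRealSubfield L)) L (IsCMField.complexConj L) 2).Adelic => φ₀) z) := by
  classical
  -- involution facts and a non-zero trace-zero element of `L`
  have hc : IsCMField.complexConj L * IsCMField.complexConj L = 1 :=
    AlgEquiv.ext fun x => by rw [AlgEquiv.mul_apply, AlgEquiv.one_apply, IsCMField.complexConj_apply_apply]
  have hc1 : IsCMField.complexConj L ≠ 1 := IsCMField.complexConj_ne_one L
  obtain ⟨δ, hcδ, hδ⟩ : ∃ δ : L, IsCMField.complexConj L δ = -δ ∧ δ ≠ 0 := by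
    obtain ⟨e, he⟩ : ∃ e : L, IsCMField.complexConj L e ≠ e := by
      by_contra h
      exact hc1 (AlgEquiv.ext fun x => not_ne_iff.mp (not_exists.mp h x))
    exact ⟨e - IsCMField.complexConj L e, by rw [map_sub, IsCMField.complexConj_apply_apply, neg_sub], sub_ne_zero.2 (Ne.symm he)⟩
  have h𝓕top : ν 𝓕 ≠ ∞ := ((measure_mono subset_closure).trans_lt h𝓕c.measure_lt_top).ne
  haveI : νG.IsMulRightInvariant := by rw [← Measure.inv_eq_self νG]; infer_instance
  have hright := measurePreserving_rightShift_of_unfolding νG hβ hμZ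
  -- exhaustion by balls (★ §1)
  refine sphericalEisenstein_meromorphic_of_balls L φ₀ fun n g => ?_
  have hk : (n : ℝ) + 3 ≤ ((n + 3 : ℕ) : ℝ) := by push_cast; exact le_rfl
  -- the structural data of the ball (★ `exists_convData_cm_two`)
  obtain ⟨a, ha, I, hIf, i₀, η, κ, T, hη, hconv, h1, hcov, hĥ₀, hκ, hcmp, hι, hne, hT, hpack⟩ := exists_convData_cm_two L μ νG hβ hμZ n
  choose hpos hinj hcl using hι
  choose hs hδι using hpack
  have hb : IotaBound (↥(maximalRealSubfield L)) L (IsCMField.complexConj L) 2 (n + 3) a μ μZ := iotaBound_cm L μ νG hβ hμZ ha (n + 3)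
  have hfin : μZ {z | a < borelQuotHeight (↥(maximalRealSubfield L)) L (IsCMField.complexConj L) 2 z} ≠ ∞ := measure_setOf_lt_ne_top_cm L μ νG hβ hμZ ha
  haveI : IsFiniteMeasure (weightedTruncMeasure (↥(maximalRealSubfield L)) L (IsCMField.complexConj L) 2 (n + 3) a μZ) := isFiniteMeasure_weightedTruncMeasure_cm L μ νG hβ hμZ ha (n + 3)
  have hfin₀ : ∀ i, IsFiniteMeasure (weightedTruncMeasure (↥(maximalRealSubfield L)) L (IsCMField.complexConj L) 2 (n + 3) (κ i * a) μZ) := fun i =>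
    isFiniteMeasure_weightedTruncMeasure_cm L μ νG hβ hμZ (hpos i) (n + 3)
  -- K2's letter at the system levels `(a, κ_i a)`
  have hK1i : ∀ i, ∃ m C : ℝ, 0 ≤ m ∧ 0 ≤ C ∧ ∀ f : HNcusp (↥(maximalRealSubfield L)) L (IsCMField.complexConj L) 2 (n + 3) a μZ, ∀ᵐ z ∂(weightedTruncMeasure (↥(maximalRealSubfield L)) L (IsCMField.complexConj L) 2 (n + 3) (κ i * a) μZ),
      ‖rightConvFun (↥(maximalRealSubfield L)) L (IsCMField.complexConj L) 2 νG ((fun (i : I) (y : (quasiSplit (↥(maximalRealSubfield L)) L (IsCMField.complexConj L) 2).Adelic) => orbitalSmoothing νG (fun x : (quasiSplit (↥(maximalRealSubfield L)) L (IsCMField.complexConj L) 2).Adelic => ((η i (adelicVal (↥(maximalRealSubfield L)) L (IsCMField.complexConj L) 2 ((StdForm.antidiagonal 2).over L) x) : ℝ) : ℂ)) (fun x : (quasiSplit (↥(maximalRealSubfield L)) L (IsCMField.complexConj L) 2).Adelic => ((η i (adelicVal (↥(maximalRealSubfield L)) L (IsCMField.complexConj L) 2 ((StdForm.antidiagonal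 2).over L) x) : ℝ) : ℂ)) y) i) ((f : HN (↥(maximalRealSubfield L)) L (IsCMField.complexConj L) 2 (n + 3) a μZ) : borelQuotient (↥(maximalRealSubfield L)) L (IsCMField.complexConj L) 2 → ℂ) z‖ ≤ C * ‖f‖ * ((borelQuotHeight (↥(maximalRealSubfield L)) L (IsCMField.complexConj L) 2 z : ℝ)) ^ (-m) := fun i =>
    hK1 (η i) (hη i).1 (hη i).2.1 (hη i).2.2.1 (hη i).2.2.2 (n + 3) a (κ i * a) (κ i) ha (hκ i).1 le_rfl (hcmp i)
  choose m C hm hC hK1' using hK1i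
  -- the constant-term vectors (★ ℓ7)
  obtain ⟨α₁, α₂, hα₁, hα₂, -, hα₂ne⟩ := exists_constantTermVectors (F := ↥(maximalRealSubfield L)) (E := L) (c := IsCMField.complexConj L) (N := 2)
    (k := n + 3) (μZ := μZ) n hk ha hfin hne
  -- the identification `zFun (H^w) = HZ^w`
  have hzF : ∀ w : ℂ, zFun (↥(maximalRealSubfield L)) L (IsCMField.complexConj L) 2 (fun g : (quasiSplit (↥(maximalRealSubfield L)) L (IsCMField.complexConj L) 2).Adelic => (((borelHeight g : ℝ)) : ℂ) ^ w) = fun x => (((borelQuotHeight (↥(maximalRealSubfield L)) L (IsCMField.complexConj L) 2 x : ℝ≥0) : ℝ) : ℂ) ^ w := by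
    intro w
    funext x
    obtain ⟨g₁, rfl⟩ : ∃ g₁, toBorelQuotient (↥(maximalRealSubfield L)) L (IsCMField.complexConj L) 2 g₁ = x := Quotient.exists_rep x
    refine zFun_toBorelQuotient (↥(maximalRealSubfield L)) L (IsCMField.complexConj L) 2 (fun γ hγ g' => ?_) g₁
    obtain ⟨γ₀, hγ₀, hγ₀B⟩ := exists_eq_toAdelic_of_mem_ratBorelSubgroup (↥(maximalRealSubfield L)) L (IsCMField.complexConj L) 2 hγ
    simp only [← hγ₀, borelHeight_rational_borel_mul γ₀ hγ₀B]
  -- the Eisenstein data on the Godement part of the ball ((b1), S1, S2)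
  have hzk : ∀ z ∈ Metric.ball (0 : ℂ) (n + 2), z.re ≤ ((n + 3 : ℕ) : ℝ) := fun z hz => by
    have h1 : z.re ≤ ‖z‖ := Complex.re_le_norm z
    have h2 : ‖z‖ < n + 2 := mem_ball_zero_iff.1 hz
    push_cast
    linarith
  have hE : ∀ z : ℂ, z ∈ Metric.ball (0 : ℂ) (n + 2) ∧ 1 < z.re → MemLp ((quasiSplit (↥(maximalRealSubfield L)) L (IsCMField.complexConj L) 2).quotFun (eisensteinSeriesU (flatSectionU (fun _ : (quasiSplit (↥(maximalRealSubfield L)) L (IsCMField.complexConj L) 2).Adelic => φ₀) z))) 2 (μ.withDensity fun x => (((supHeight (↥(maximalRealSubfield L)) L (IsCMField.complexConj L) 2 x)⁻¹ ^ (2 * (n + 3)) : ℝ≥0) : ℝ≥0∞)) := fun z hz =>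
    eisensteinSeriesU_flatSectionU_memHX_cm_two L hcδ hδ ν h𝓕N h𝓕c μ φ₀ (n + 3) hz.2 (hzk z hz.1)
  have hαF₁ : ∀ z ∈ Metric.ball (0 : ℂ) (n + 2), MemLp (zFun (↥(maximalRealSubfield L)) L (IsCMField.complexConj L) 2 (fun g : (quasiSplit (↥(maximalRealSubfield L)) L (IsCMField.complexConj L) 2).Adelic => (((borelHeight g : ℝ)) : ℂ) ^ z)) 2
      (weightedTruncMeasure (↥(maximalRealSubfield L)) L (IsCMField.complexConj L) 2 (n + 3) a μZ) := fun z hz => by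
    rw [hzF]; exact (Lp.memLp (α₁ z)).ae_eq (hα₁ z hz)
  have hαF₂ : ∀ z ∈ Metric.ball (0 : ℂ) (n + 2), MemLp (zFun (↥(maximalRealSubfield L)) L (IsCMField.complexConj L) 2 (fun g : (quasiSplit (↥(maximalRealSubfield L)) L (IsCMField.complexConj L) 2).Adelic => (((borelHeight g : ℝ)) : ℂ) ^ (1 - z))) 2
      (weightedTruncMeasure (↥(maximalRealSubfield L)) L (IsCMField.complexConj L) 2 (n + 3) a μZ) := fun z hz => by
    rw [hzF]; exact (Lp.memLp (α₂ z)).ae_eq (hα₂ z hz)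
  have htoHN₁ : ∀ z (hz : z ∈ Metric.ball (0 : ℂ) (n + 2)),
      toHN (↥(maximalRealSubfield L)) L (IsCMField.complexConj L) 2 (n + 3) a μZ (fun g : (quasiSplit (↥(maximalRealSubfield L)) L (IsCMField.complexConj L) 2).Adelic => (((borelHeight g : ℝ)) : ℂ) ^ z) (hαF₁ z hz) = α₁ z := fun z hz =>
    Lp.ext ((coeFn_toHN (↥(maximalRealSubfield L)) L (IsCMField.complexConj L) 2 (n + 3) a μZ _ (hαF₁ z hz)).trans (by rw [hzF]; exact (hα₁ z hz).symm))
  have htoHN₂ : ∀ z (hz : z ∈ Metric.ball (0 : ℂ) (n + 2)),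
      toHN (↥(maximalRealSubfield L)) L (IsCMField.complexConj L) 2 (n + 3) a μZ (fun g : (quasiSplit (↥(maximalRealSubfield L)) L (IsCMField.complexConj L) 2).Adelic => (((borelHeight g : ℝ)) : ℂ) ^ (1 - z)) (hαF₂ z hz) = α₂ z := fun z hz =>
    Lp.ext ((coeFn_toHN (↥(maximalRealSubfield L)) L (IsCMField.complexConj L) 2 (n + 3) a μZ _ (hαF₂ z hz)).trans (by rw [hzF]; exact (hα₂ z hz).symm))
  -- the disintegration letter of S2, paid by ★ `integral_zFun_borelConstantTerm_eq_of_unfolding` (`hconj` ★ at `N = 2`)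
  have hdis' : ∀ Φ : (quasiSplit (↥(maximalRealSubfield L)) L (IsCMField.complexConj L) 2).Adelic → ℂ, Measurable Φ → (∀ b ∈ ratBorelSubgroup (↥(maximalRealSubfield L)) L (IsCMField.complexConj L) 2, ∀ g, Φ (b * g) = Φ g) →
      Integrable (zFun (↥(maximalRealSubfield L)) L (IsCMField.complexConj L) 2 Φ) (weightedTruncMeasure (↥(maximalRealSubfield L)) L (IsCMField.complexConj L) 2 (n + 3) a μZ) →
      Integrable (zFun (↥(maximalRealSubfield L)) L (IsCMField.complexConj L) 2 (borelConstantTerm ν 𝓕 Φ)) (weightedTruncMeasure (↥(maximalRealSubfield L)) L (IsCMField.complexConj L) 2 (n + 3) a μZ) →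
        ∫ x, zFun (↥(maximalRealSubfield L)) L (IsCMField.complexConj L) 2 (borelConstantTerm ν 𝓕 Φ) x ∂(weightedTruncMeasure (↥(maximalRealSubfield L)) L (IsCMField.complexConj L) 2 (n + 3) a μZ) =
          ∫ x, zFun (↥(maximalRealSubfield L)) L (IsCMField.complexConj L) 2 Φ x ∂(weightedTruncMeasure (↥(maximalRealSubfield L)) L (IsCMField.complexConj L) 2 (n + 3) a μZ) := fun Φ hΦm hΦB hint hint' =>
    integral_zFun_borelConstantTerm_eq_of_unfolding νG ν (fun _ hb₀ => map_conj_toAdelic_eq_self_two hc hc1 ν hb₀) h𝓕N h𝓕₀ h𝓕top hβ hμZ (n + 3) a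
      hΦm hΦB hint hint'
  have hS2 : ∀ z (hz : z ∈ Metric.ball (0 : ℂ) (n + 2) ∧ 1 < z.re), ∃ b : ℂ,
      cnstN (↥(maximalRealSubfield L)) L (IsCMField.complexConj L) 2 (n + 3) a μZ (iota hb (toHX (↥(maximalRealSubfield L)) L (IsCMField.complexConj L) 2 (n + 3) μ (eisensteinSeriesU (flatSectionU (fun _ : (quasiSplit (↥(maximalRealSubfield L)) L (IsCMField.complexConj L) 2).Adelic => φ₀) z)) (hE z hz))) = φ₀ • α₁ z + b • α₂ z := fun z hz => by
    obtain ⟨b, hb'⟩ := exists_cnstN_iota_toHX_eisensteinSeriesU_eq_cm_two L ν h𝓕N h𝓕c hb hdis' φ₀ hz.2 (hE z hz) (hαF₁ z hz.1) (hαF₂ z hz.1)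
    rw [htoHN₁ z hz.1, htoHN₂ z hz.1] at hb'
    exact ⟨b, hb'⟩
  choose bX' hbX' using hS2
  -- the solution pair `(eX, bX)` (zero off the Godement part of the ball)
  obtain ⟨eX, heX⟩ : ∃ eX : ℂ → HX (↥(maximalRealSubfield L)) L (IsCMField.complexConj L) 2 (n + 3) μ, eX = fun z =>
      if hz : z ∈ Metric.ball (0 : ℂ) (n + 2) ∧ 1 < z.re then toHX (↥(maximalRealSubfield L)) L (IsCMField.complexConj L) 2 (n + 3) μ (eisensteinSeriesU (flatSectionU (fun _ : (quasiSplit (↥(maximalRealSubfield L)) L (IsCMField.complexConj L) 2).Adelic => φ₀) z)) (hE z hz) else 0 := ⟨_, rfl⟩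
  obtain ⟨bX, hbX⟩ : ∃ bX : ℂ → ℂ, bX = fun z => if hz : z ∈ Metric.ball (0 : ℂ) (n + 2) ∧ 1 < z.re then bX' z hz else 0 := ⟨_, rfl⟩
  have heXz : ∀ z (hz : z ∈ Metric.ball (0 : ℂ) (n + 2) ∧ 1 < z.re), eX z = toHX (↥(maximalRealSubfield L)) L (IsCMField.complexConj L) 2 (n + 3) μ (eisensteinSeriesU (flatSectionU (fun _ : (quasiSplit (↥(maximalRealSubfield L)) L (IsCMField.complexConj L) 2).Adelic => φ₀) z)) (hE z hz) := fun z hz => by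
    rw [heX]; exact dif_pos hz
  have hsolT : ∀ z ∈ Metric.ball (0 : ℂ) (n + 2), 1 < z.re → ∀ i,
      T i (eX z) = (∫ x, (fun (i : I) (y : (quasiSplit (↥(maximalRealSubfield L)) L (IsCMField.complexConj L) 2).Adelic) => orbitalSmoothing νG (fun x : (quasiSplit (↥(maximalRealSubfield L)) L (IsCMField.complexConj L) 2).Adelic => ((η i (adelicVal (↥(maximalRealSubfield L)) L (IsCMField.complexConj L) 2 ((StdForm.antidiagonal 2).over L) x) : ℝ) : ℂ)) (fun x : (quasiSplit (↥(maximalRealSubfield L)) L (IsCMField.complexConj L) 2).Adelic => ((η i (adelicVal (↥(maximalRealSubfield L)) L (IsCMField.complexConj L) 2 ((StdForm.antidiagonal 2).over L) x) : ℝ) : ℂ)) y) i x * (((borelHeight x : ℝ≥0) : ℝ) : ℂ) ^ z ∂νG) • eX z := fun z hz hz1 i => by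
    rw [heXz z ⟨hz, hz1⟩]
    exact shiftOperatorX_toHX_eisensteinSeriesU_eq_smul_cm_two L μ νG (hconv i).2.2.1 (hconv i).1 (hconv i).2.1 φ₀ hz1 (hE z ⟨hz, hz1⟩) (T i) (hT i)
  have hsolC : ∀ z ∈ Metric.ball (0 : ℂ) (n + 2), 1 < z.re →
      cnstN (↥(maximalRealSubfield L)) L (IsCMField.complexConj L) 2 (n + 3) a μZ (iota hb (eX z)) = φ₀ • α₁ z + bX z • α₂ z := fun z hz hz1 => by
    rw [heXz z ⟨hz, hz1⟩, hbX]
    dsimp only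
    rw [dif_pos ⟨hz, hz1⟩]
    exact hbX' z ⟨hz, hz1⟩
  have hsolQ : ∀ z ∈ Metric.ball (0 : ℂ) (n + 2), 1 < z.re → (0 : HX (↥(maximalRealSubfield L)) L (IsCMField.complexConj L) 2 (n + 3) μ →L[ℂ] HX (↥(maximalRealSubfield L)) L (IsCMField.complexConj L) 2 (n + 3) μ) (eX z) = 0 := fun _ _ _ => rfl
  -- the essential bound of `δ(α₂ z)` (★ payer) and the uniqueness letter (★ P6′ one-call)
  have hδα₂ : ∀ z ∈ Metric.ball (0 : ℂ) (n + 2), 1 < z.re → ∃ M : ℝ, ∀ᵐ x ∂(weightedTruncMeasure (↥(maximalRealSubfield L)) L (IsCMField.complexConj L) 2 (n + 3) (κ i₀ * a) μZ),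
      ‖(deltaShift (hs i₀) (α₂ z) : borelQuotient (↥(maximalRealSubfield L)) L (IsCMField.complexConj L) 2 → ℂ) x‖ ≤ M := fun z hz hz1 =>
    exists_ae_norm_deltaShift_le_of_ae_eq_cpow hright (isClosed_tsupport _).measurableSet (lt_of_lt_of_le zero_lt_one (hκ i₀).1) le_rfl (hcmp i₀)
      (fun y hy => image_eq_zero_of_notMem_tsupport hy) ((hconv i₀).1.integrable_of_hasCompactSupport (hconv i₀).2.1) (hs i₀) ha (hα₂ z hz)
      (by rw [Complex.sub_re, Complex.one_re]; linarith)
  have hunq := hunq_cm_two L μ νG hβ hμZ (n + 3) n i₀ (h := (fun (i : I) (y : (quasiSplit (↥(maximalRealSubfield L)) L (IsCMField.complexConj L) 2).Adelic) => orbitalSmoothing νG (fun x : (quasiSplit (↥(maximalRealSubfield L)) L (IsCMField.complexConj L) 2).Adelic => ((η i (adelicVal (↥(maximalRealSubfield L)) L (IsCMField.complexConj L) 2 ((StdForm.antidiagonal 2).over L) x) : ℝ) : ℂ)) (fun x : (quasiSplit (↥(maximalRealSubfield L)) L (IsCMField.complexConj L) 2).Adelic => ((η i (adelicVal (↥(maximalRealSubfield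 L)) L (IsCMField.complexConj L) 2 ((StdForm.antidiagonal 2).over L) x) : ℝ) : ℂ)) y)) (fun i => (hconv i).1) (fun i => (hconv i).2.1) (hconv i₀).2.2.2.1
    (hconv i₀).2.2.2.2.1 (hconv i₀).2.2.2.2.2 h1 (hpos i₀) (hκ i₀).2 hfin hb (hs i₀) T (hT i₀) (hδι i₀ (hκ i₀).2) (hC i₀) (hm i₀) (hK1' i₀) α₁ α₂ hδα₂
    (0 : HX (↥(maximalRealSubfield L)) L (IsCMField.complexConj L) 2 (n + 3) μ →L[ℂ] HX (↥(maximalRealSubfield L)) L (IsCMField.complexConj L) 2 (n + 3) μ) φ₀ eX bX hsolT hsolC hsolQ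
  -- the evaluation functional (★ P3-D, on the real test function `Re h_{i₀} = h_{i₀}`)
  have hre : ∀ x, ((((fun (i : I) (y : (quasiSplit (↥(maximalRealSubfield L)) L (IsCMField.complexConj L) 2).Adelic) => orbitalSmoothing νG (fun x : (quasiSplit (↥(maximalRealSubfield L)) L (IsCMField.complexConj L) 2).Adelic => ((η i (adelicVal (↥(maximalRealSubfield L)) L (IsCMField.complexConj L) 2 ((StdForm.antidiagonal 2).over L) x) : ℝ) : ℂ)) (fun x : (quasiSplit (↥(maximalRealSubfield L)) L (IsCMField.complexConj L) 2).Adelic => ((η i (adelicVal (↥(maximalRealSubfield L)) L (IsCMField.complexConj L) 2 ((StdForm.antidiagonal 2).over L) x) : ℝ) : ℂ)) y) i₀ x).re : ℝ) : ℂ) = (fun (i : I) (y : (quasiSplit (↥(maximalRealSubfield L)) L (IsCMField.complexConj L) 2).Adelic) => orbitalSmoothing νG (fun x : (quasiSplit (↥(maximalRealSubfield L)) L (IsCMField.complexConj L) 2).Adelic => ((η i (adelicVal (↥(maximalRealSubfield L)) L (IsCMField.complexConj L) 2 ((StdForm.antidiagonal 2).over L) x) : ℝ) : ℂ)) (fun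 x : (quasiSplit (↥(maximalRealSubfield L)) L (IsCMField.complexConj L) 2).Adelic => ((η i (adelicVal (↥(maximalRealSubfield L)) L (IsCMField.complexConj L) 2 ((StdForm.antidiagonal 2).over L) x) : ℝ) : ℂ)) y) i₀ x := fun x => Complex.conj_eq_iff_re.1 ((hconv i₀).2.2.2.2.1 x)
  obtain ⟨Λ, hΛ⟩ := exists_evalCLM_eisenstein_cm_two L μ νG (n + 3) (h := fun x => ((fun (i : I) (y : (quasiSplit (↥(maximalRealSubfield L)) L (IsCMField.complexConj L) 2).Adelic) => orbitalSmoothing νG (fun x : (quasiSplit (↥(maximalRealSubfield L)) L (IsCMField.complexConj L) 2).Adelic => ((η i (adelicVal (↥(maximalRealSubfield L)) L (IsCMField.complexConj L) 2 ((StdForm.antidiagonal 2).over L) x) : ℝ) : ℂ)) (fun x : (quasiSplit (↥(maximalRealSubfield L)) L (IsCMField.complexConj L) 2).Adelic => ((η i (adelicVal (↥(maximalRealSubfield L)) L (IsCMField.complexConj L) 2 ((StdForm.antidiagonal 2).over L) x) : ℝ) : ℂ)) y) i₀ x).re)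
    (fun k₀ hk₀ x => by simp only [(hconv i₀).2.2.1 k₀ hk₀ x]) (Complex.continuous_re.comp (hconv i₀).1)
    ((hconv i₀).2.1.comp_left Complex.zero_re) φ₀ g
  have hΛ' : ∀ z ∈ Metric.ball (0 : ℂ) (n + 2), 1 < z.re →
      Λ (eX z) = (∫ x, (fun (i : I) (y : (quasiSplit (↥(maximalRealSubfield L)) L (IsCMField.complexConj L) 2).Adelic) => orbitalSmoothing νG (fun x : (quasiSplit (↥(maximalRealSubfield L)) L (IsCMField.complexConj L) 2).Adelic => ((η i (adelicVal (↥(maximalRealSubfield L)) L (IsCMField.complexConj L) 2 ((StdForm.antidiagonal 2).over L) x) : ℝ) : ℂ)) (fun x : (quasiSplit (↥(maximalRealSubfield L)) L (IsCMField.complexConj L) 2).Adelic => ((η i (adelicVal (↥(maximalRealSubfield L)) L (IsCMField.complexConj L) 2 ((StdForm.antidiagonal 2).over L) x) : ℝ) : ℂ)) y) i₀ x * (((borelHeight x : ℝ≥0) : ℝ) : ℂ) ^ z ∂νG) * eisensteinSeriesU (flatSectionU (fun _ : (quasiSplit (↥(maximalRealSubfield L)) L (IsCMField.complexConj L) 2).Adelic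 => φ₀) z) g := by
    intro z hz hz1
    rw [heXz z ⟨hz, hz1⟩, hΛ z hz1 (hE z ⟨hz, hz1⟩)]
    simp only [hre]
  -- ★ §2 on the ball
  exact sphericalEisenstein_meromorphicOn_ball_of_letters n (n + 3) hk νG i₀ ha (a₀ := fun i => κ i * a) (fun i => (hκ i).2) hfin (hfin₀ := hfin₀) hb
    (fun i => iotaBound_cm L μ νG hβ hμZ (hpos i) (n + 3)) hcl hinj (fun (i : I) (y : (quasiSplit (↥(maximalRealSubfield L)) L (IsCMField.complexConj L) 2).Adelic) => orbitalSmoothing νG (fun x : (quasiSplit (↥(maximalRealSubfield L)) L (IsCMField.complexConj L) 2).Adelic => ((η i (adelicVal (↥(maximalRealSubfield L)) L (IsCMField.complexConj L) 2 ((StdForm.antidiagonal 2).over L) x) : ℝ) : ℂ)) (fun x : (quasiSplit (↥(maximalRealSubfield L)) L (IsCMField.complexConj L) 2).Adelic => ((η i (adelicVal (↥(maximalRealSubfield L)) L (IsCMField.complexConj L) 2 ((StdForm.antidiagonal 2).over L) x) : ℝ) : ℂ)) y) (fun i => (hconv i).1) (fun i => (hconv i).2.1) hcov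
    ⟨0, Metric.mem_ball_self (by positivity), hĥ₀⟩ hs hm hC hK1' T (fun i => hδι i (hκ i).2) hα₁ hα₂ hα₂ne
    (0 : HX (↥(maximalRealSubfield L)) L (IsCMField.complexConj L) 2 (n + 3) μ →L[ℂ] HX (↥(maximalRealSubfield L)) L (IsCMField.complexConj L) 2 (n + 3) μ) φ₀ eX bX hsolT hsolC hsolQ hunq g Λ hΛ'

/-! ## ED. 2 (append-only; dealer K2E1-plan (g6) ruling (34) «ED. 2 … the hour those land», 2026-09-04): `hK1` DISCHARGED by ★ p859321 `hK1_cm_two_of` (K2E1-p11) down to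
K2-defs1's every-rank cusp-vanishing statement `hcuspN` («for `f ∈ 𝓗_k(Z_{c₁})^cusp`, the Borel constant term of `𝟙_{Z_{c₁}}·f ∘ π` vanishes `νG`-a.e. above height `c₁`», for every Haar `νN`
and every fundamental domain of `N(F)` of finite non-zero measure) — the closer modulo that single STRUCTURAL statement; ED. 3 drops it by K2-defs1's
`ae_borelConstantTerm_indicator_comp_eq_zero_of_mem_HNcusp` (∘ ★ `map_conj_toAdelic_eq_self_two`) the hour it lands. -/

/-- **THE MEROMORPHIC CONTINUATION OF THE SPHERICAL BOREL EISENSTEIN SERIES ON `U(1,1)_{L/L⁺}` TO ALL OF `ℂ`, MODULO THE CUSP-VANISHING STATEMENT `hcuspN`** (ED. 2): ED. 1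
`sphericalEisenstein_meromorphic_cm_two_of_hK1` with its letter `hK1` paid by ★ `K2E1TruncatedCuspDecayHK1CMTwo.hK1_cm_two_of` (K1's high-cusp decay ★ p859116, the tile∕bridge data ★
p859247∕p859282, the BAND bound ★ p859236∕p859263) at `m = 0`, for every smooth symmetric bi-`K`-invariant `η`, all `k` and all levels `0 < c₁`, `κ c₁ ≤ c₀` (`κ ≥ 1`).
[cite: BernsteinLapid2019, Thm 2.3, §2.4 and §4 Claims 1–5 (pp. 9–10)] [cite: Langlands1976, §7] [cite: MoeglinWaldspurger1995, IV.1.8–IV.1.10] -/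
theorem sphericalEisenstein_meromorphic_cm_two_of_hcuspN
    (μ : Measure (quasiSplit (↥(maximalRealSubfield L)) L (IsCMField.complexConj L) 2).automorphicQuotient) [(quasiSplit (↥(maximalRealSubfield L)) L (IsCMField.complexConj L) 2).IsAutomorphicMeasure μ]
    (νG : Measure (quasiSplit (↥(maximalRealSubfield L)) L (IsCMField.complexConj L) 2).Adelic) [νG.IsHaarMeasure] [νG.IsInvInvariant] [SFinite νG]
    (ν : Measure ↥(adelicUnipotent (↥(maximalRealSubfield L)) L (IsCMField.complexConj L) 2)) [ν.IsHaarMeasure] [ν.IsMulRightInvariant] [ν.IsInvInvariant]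
    {𝓕 : Set ↥(adelicUnipotent (↥(maximalRealSubfield L)) L (IsCMField.complexConj L) 2)}
    (h𝓕N : IsFundamentalDomain ↥(rationalUnipotent (↥(maximalRealSubfield L)) L (IsCMField.complexConj L) 2) 𝓕 ν) (h𝓕c : IsCompact (closure 𝓕)) (h𝓕₀ : ν 𝓕 ≠ 0)
    {β : (quasiSplit (↥(maximalRealSubfield L)) L (IsCMField.complexConj L) 2).Adelic → ℝ≥0∞}
    (hβ : IsCoveringWeight ↥((arithmeticBorel (↥(maximalRealSubfield L)) L (IsCMField.complexConj L) 2).map (quasiSplit (↥(maximalRealSubfield L)) L (IsCMField.complexConj L) 2).arithmeticSubgroup.subtype) β)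
    {μZ : Measure (borelQuotient (↥(maximalRealSubfield L)) L (IsCMField.complexConj L) 2)} [SFinite μZ]
    (hμZ : ∀ f : borelQuotient (↥(maximalRealSubfield L)) L (IsCMField.complexConj L) 2 → ℝ≥0∞, Measurable f → ∫⁻ z, f z ∂μZ = ∫⁻ g, β g * f (toBorelQuotient (↥(maximalRealSubfield L)) L (IsCMField.complexConj L) 2 g) ∂νG)
    -- THE remaining (structural) letter: K2-defs1's every-rank cusp-vanishing statement at `N = 2`
    (hcuspN : ∀ (k : ℕ) (c₁ : ℝ≥0), 0 < c₁ →
      ∀ (νN : Measure ↥(adelicUnipotent (↥(maximalRealSubfield L)) L (IsCMField.complexConj L) 2)) [νN.IsHaarMeasure] [νN.IsInvInvariant] [νN.IsMulRightInvariant] (𝓕N : Set ↥(adelicUnipotent (↥(maximalRealSubfield L)) L (IsCMField.complexConj L) 2)),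
      IsFundamentalDomain ↥(rationalUnipotent (↥(maximalRealSubfield L)) L (IsCMField.complexConj L) 2) 𝓕N νN → νN 𝓕N ≠ 0 → νN 𝓕N ≠ ⊤ → ∀ f : ↥(HNcusp (↥(maximalRealSubfield L)) L (IsCMField.complexConj L) 2 k c₁ μZ), ∀ᵐ g ∂νG, c₁ < borelHeight g →
        borelConstantTerm νN 𝓕N (({z : borelQuotient (↥(maximalRealSubfield L)) L (IsCMField.complexConj L) 2 | c₁ < borelQuotHeight (↥(maximalRealSubfield L)) L (IsCMField.complexConj L) 2 z}.indicator ((f : HN (↥(maximalRealSubfield L)) L (IsCMField.complexConj L) 2 k c₁ μZ) : borelQuotient (↥(maximalRealSubfield L)) L (IsCMField.complexConj L) 2 → ℂ)) ∘ toBorelQuotient (↥(maximalRealSubfield L)) L (IsCMField.complexConj L) 2) g = 0)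
    (φ₀ : ℂ) :
    ∃ Ec : ℂ → (quasiSplit (↥(maximalRealSubfield L)) L (IsCMField.complexConj L) 2).Adelic → ℂ,
      (∀ g, MeromorphicOn (fun z => Ec z g) univ) ∧
      ∀ z : ℂ, 1 < z.re → Ec z = eisensteinSeriesU (flatSectionU (fun _ : (quasiSplit (↥(maximalRealSubfield L)) L (IsCMField.complexConj L) 2).Adelic => φ₀) z) := by
  letI : MeasurableSpace (AdeleRing (𝓞 L) L) := borel _
  haveI : BorelSpace (AdeleRing (𝓞 L) L) := ⟨rfl⟩
  haveI : νG.IsMulRightInvariant := by rw [← Measure.inv_eq_self νG]; infer_instance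
  refine sphericalEisenstein_meromorphic_cm_two_of_hK1 L μ νG ν h𝓕N h𝓕c h𝓕₀ hβ hμZ (fun η hη _ _ _ k c₁ c₀ κ hc₁ hκ hκc hΩ => ?_) φ₀
  have hc₀ : 0 < c₀ := lt_of_lt_of_le (lt_of_lt_of_le hc₁ (le_mul_of_one_le_left c₁.2 hκ)) hκc
  obtain ⟨C, hC, h⟩ := K2E1TruncatedCuspDecayHK1CMTwo.hK1_cm_two_of L μZ νG hβ hμZ hη k c₁ c₀ hc₀ (hcuspN k c₁ hc₁) (lt_of_lt_of_le zero_lt_one hκ) hκc hΩ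
    (le_refl (0 : ℝ))
  exact ⟨0, C, le_rfl, hC, h⟩

/-! ## ED. 3 (append-only; dealer K2E1-plan (g6) ruling (65) «closer ED. 2 hK1-free — GO», 2026-09-04): `hcuspN` DISCHARGED by ★ p859335
`K2E1TruncatedCuspConstantTermAEU2.ae_borelConstantTerm_indicator_comp_eq_zero_of_mem_HNcusp` (K2-defs1, every rank) with its conjugation letter `hconj` paid at `N = 2` by ★
`map_conj_toAdelic_eq_self_two` — **THE LETTER-FREE CLOSER**: the only hypotheses left are the STRUCTURAL measures (`μ`, `νG`, `ν` with a relatively compact fundamental domain of `N(F)` of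
non-zero measure, the covering weight `β` with its unfolded measure `μZ`). -/

/-- **THE MEROMORPHIC CONTINUATION OF THE SPHERICAL BOREL EISENSTEIN SERIES ON `U(1,1)_{L/L⁺}` TO ALL OF `ℂ`** (ED. 3, letter-free) [BernsteinLapid2019, Thm 2.3, §4 Claims 1–5]: for every
`φ₀ : ℂ` there is `Ec : ℂ → (G(𝔸) → ℂ)` with `z ↦ Ec z g` meromorphic on all of `ℂ` for every `g ∈ G(𝔸)` and `Ec z = E(φ₀H^z)` whenever `1 < Re z` — ED. 2 with `hcuspN` := ★ (ii) ∘ ★ `hconj`₂.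
Hypotheses: structural measures only (module docstring).
[cite: BernsteinLapid2019, Thm 2.3, §2.4 and §4 Claims 1–5 (pp. 9–10)] [cite: Langlands1976, §7] [cite: MoeglinWaldspurger1995, IV.1.8–IV.1.10] -/
theorem sphericalEisenstein_meromorphic_cm_two
    (μ : Measure (quasiSplit (↥(maximalRealSubfield L)) L (IsCMField.complexConj L) 2).automorphicQuotient) [(quasiSplit (↥(maximalRealSubfield L)) L (IsCMField.complexConj L) 2).IsAutomorphicMeasure μ]
    (νG : Measure (quasiSplit (↥(maximalRealSubfield L)) L (IsCMField.complexConj L) 2).Adelic) [νG.IsHaarMeasure] [νG.IsInvInvariant] [SFinite νG]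
    (ν : Measure ↥(adelicUnipotent (↥(maximalRealSubfield L)) L (IsCMField.complexConj L) 2)) [ν.IsHaarMeasure] [ν.IsMulRightInvariant] [ν.IsInvInvariant]
    {𝓕 : Set ↥(adelicUnipotent (↥(maximalRealSubfield L)) L (IsCMField.complexConj L) 2)}
    (h𝓕N : IsFundamentalDomain ↥(rationalUnipotent (↥(maximalRealSubfield L)) L (IsCMField.complexConj L) 2) 𝓕 ν) (h𝓕c : IsCompact (closure 𝓕)) (h𝓕₀ : ν 𝓕 ≠ 0)
    {β : (quasiSplit (↥(maximalRealSubfield L)) L (IsCMField.complexConj L) 2).Adelic → ℝ≥0∞}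
    (hβ : IsCoveringWeight ↥((arithmeticBorel (↥(maximalRealSubfield L)) L (IsCMField.complexConj L) 2).map (quasiSplit (↥(maximalRealSubfield L)) L (IsCMField.complexConj L) 2).arithmeticSubgroup.subtype) β)
    {μZ : Measure (borelQuotient (↥(maximalRealSubfield L)) L (IsCMField.complexConj L) 2)} [SFinite μZ]
    (hμZ : ∀ f : borelQuotient (↥(maximalRealSubfield L)) L (IsCMField.complexConj L) 2 → ℝ≥0∞, Measurable f → ∫⁻ z, f z ∂μZ = ∫⁻ g, β g * f (toBorelQuotient (↥(maximalRealSubfield L)) L (IsCMField.complexConj L) 2 g) ∂νG)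
    (φ₀ : ℂ) :
    ∃ Ec : ℂ → (quasiSplit (↥(maximalRealSubfield L)) L (IsCMField.complexConj L) 2).Adelic → ℂ,
      (∀ g, MeromorphicOn (fun z => Ec z g) univ) ∧
      ∀ z : ℂ, 1 < z.re → Ec z = eisensteinSeriesU (flatSectionU (fun _ : (quasiSplit (↥(maximalRealSubfield L)) L (IsCMField.complexConj L) 2).Adelic => φ₀) z) := by
  have hc : IsCMField.complexConj L * IsCMField.complexConj L = 1 :=
    AlgEquiv.ext fun x => by rw [AlgEquiv.mul_apply, AlgEquiv.one_apply, IsCMField.complexConj_apply_apply]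
  have hc1 : IsCMField.complexConj L ≠ 1 := IsCMField.complexConj_ne_one L
  exact sphericalEisenstein_meromorphic_cm_two_of_hcuspN L μ νG ν h𝓕N h𝓕c h𝓕₀ hβ hμZ
    (fun k c₁ _ νN _ _ _ 𝓕N h𝓕 h0 htop f =>
      K2E1TruncatedCuspConstantTermAEU2.ae_borelConstantTerm_indicator_comp_eq_zero_of_mem_HNcusp νG νN
        (fun _ hb₀ => map_conj_toAdelic_eq_self_two hc hc1 νN hb₀) h𝓕 h0 htop hβ hμZ k c₁ f) φ₀

end Summit.HodgeConjecture.HodgeConjecture.Cruxes.H413.K2E1SphericalEisensteinMeromorphicU2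

end
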